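import Summits.NavierStokesRegularity.NavierStokesRegularity.Theorems.FilamentSkeletonRssKelvinGateNeumann

/-!
# Route `FilamentSkeletonRss` · «A1R-acc» S2b-acc assembly tool, parametric half — TIGHTNESS and LOCAL CONTINUITY of the Neumann solution operator
# (clauses (3)–(4) of `DefectGateSpecAcc` for a gate assembled from an approximate one)

Helper file (theorems only), `--supports stmt-NavierStokesRegularity-23611 --as helper`; LEAD of 23611, lane ns-filament-21221-p1 g13.

`…KelvinGateBorderedNeumann` (`borderedGate_of_approximate`) turns an approximate bordered right inverse with a Y-contracting defect `R` into an exact one at ONE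
parameter, by composing with the Neumann solution operator `N` of `F′ = F + R F′` (`…KelvinGateNeumann`, p606450).  The gate spec of the acc-line also asks
(3) TIGHTNESS uniformly on the parameter box (data small on a large ball ⇒ output small on a given ball) and (4) LOCAL CONTINUITY in the parameter at fixed data.
This file transfers both through `N`, for a family `R_π` (`π` in a set `S` of a pseudo-metric space) that is Y-contracting (`θ ≤ ½`), linear, TIGHT in values
(uniformly in `π`) and locally continuous in `π` on balls:

* `neumannIter`, `neumannIter_bound`, `neumannIter_sub_solution` — the iterates `G₀ = 0`, `G_{k+1} = F + R G_k` stay in the `2Y(F)`-ball and approach ANY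
  Y-bounded solution geometrically, `Y(G_k − F′) ≤ 2Y(F)·(1/2)^k`;
* `neumannIter_tight`, `neumann_tight` — the iterates, hence the solution operator, are tight in values, uniformly in `π`;
* `neumann_locClose` — `π ↦ N_π F` is locally continuous on balls (values): `N_π F − N_π′ F = N_π′((R_π − R_π′) N_π F)`.
With (3)/(4) for `K₀, c` these give (3)/(4) for `K₀ ∘ N`, `c ∘ N` (`gate_tight_of_approximate`, `gate_locClose_of_approximate`).

HONEST FRAMING: linear fixed-point bookkeeping for the gate vocabulary of a HYPOTHETICAL blow-up route (MODEL rung, negative side); nothing here bears on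
Navier–Stokes regularity; no stub is closed by this file.
-/

set_option linter.dupNamespace false

noncomputable section

namespace Summit.NavierStokesRegularity.NavierStokesRegularity.Theorems.KelvinGate

open Set Function Filter Topology Metric
open Literature.Analysis.FluidPDE
open scoped InnerProductSpace ContDiff Topology BigOperators

/-! ## Neumann iterates at one parameter -/

section One

variable {Rm : (EuclideanSpace ℝ (Fin 3) → EuclideanSpace ℝ (Fin 3)) → EuclideanSpace ℝ (Fin 3) → EuclideanSpace ℝ (Fin 3)} {θ : ℝ}

/-- The Neumann iterates `G₀ = 0`, `G_{k+1} = F + R G_k`. -/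
def neumannIter (Rm : (EuclideanSpace ℝ (Fin 3) → EuclideanSpace ℝ (Fin 3)) → EuclideanSpace ℝ (Fin 3) → EuclideanSpace ℝ (Fin 3))
    (F : EuclideanSpace ℝ (Fin 3) → EuclideanSpace ℝ (Fin 3)) (k : ℕ) : EuclideanSpace ℝ (Fin 3) → EuclideanSpace ℝ (Fin 3) :=
  (fun G => fun y => F y + Rm G y)^[k] (fun _ => 0)

/-- `G₀ = 0`. -/
theorem neumannIter_zero (F : EuclideanSpace ℝ (Fin 3) → EuclideanSpace ℝ (Fin 3)) : neumannIter Rm F 0 = fun _ => 0 := rfl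

/-- `G_{k+1} = F + R G_k`. -/
theorem neumannIter_succ (F : EuclideanSpace ℝ (Fin 3) → EuclideanSpace ℝ (Fin 3)) (k : ℕ) :
    neumannIter Rm F (k + 1) = fun y => F y + Rm (neumannIter Rm F k) y :=
  Function.iterate_succ_apply' _ k _

/-- The iterates stay in the ball `Y ≤ 2Y(F)`. -/
theorem neumannIter_bound
    (hR1 : ∀ (G : EuclideanSpace ℝ (Fin 3) → EuclideanSpace ℝ (Fin 3)) (S : ℝ), YBound G S → YBound (Rm G) (θ * S)) (hθ : θ ≤ 1 / 2)
    {F : EuclideanSpace ℝ (Fin 3) → EuclideanSpace ℝ (Fin 3)} {R₀ : ℝ} (hF : YBound F R₀) (k : ℕ) :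
    YBound (neumannIter Rm F k) (2 * R₀) := by
  have hR₀ : 0 ≤ R₀ := hF.nonneg
  induction k with
  | zero => rw [neumannIter_zero]; exact yBound_zero.mono (by linarith)
  | succ k ih =>
    rw [neumannIter_succ]
    have h := hF.add (hR1 _ _ ih)
    refine h.mono ?_
    nlinarith

/-- The iterates approach ANY Y-bounded solution `F′ = F + R F′` geometrically: `Y(G_k − F′) ≤ S′·(1/2)^k` if `Y(F′) ≤ S′`. -/
theorem neumannIter_sub_solution
    (hR1 : ∀ (G : EuclideanSpace ℝ (Fin 3) → EuclideanSpace ℝ (Fin 3)) (S : ℝ), YBound G S → YBound (Rm G) (θ * S))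
    (hR2 : ∀ (F G : EuclideanSpace ℝ (Fin 3) → EuclideanSpace ℝ (Fin 3)) (s : ℝ), (∃ S, YBound F S) → (∃ S, YBound G S) →
      Rm (fun y => F y + s • G y) = fun y => Rm F y + s • Rm G y) (hθ : θ ≤ 1 / 2)
    {F F' : EuclideanSpace ℝ (Fin 3) → EuclideanSpace ℝ (Fin 3)} {R₀ S' : ℝ} (hF : YBound F R₀) (hF' : YBound F' S')
    (hsol : ∀ y, F' y = F y + Rm F' y) (k : ℕ) :
    YBound (fun y => neumannIter Rm F k y - F' y) (S' * (1 / 2) ^ k) := by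
  induction k with
  | zero =>
    simp only [neumannIter_zero, zero_sub, pow_zero, mul_one]
    exact hF'.neg
  | succ k ih =>
    have hGk := neumannIter_bound hR1 hθ hF k
    -- `G_{k+1} − F′ = R(G_k − F′)`
    have hsub : ∀ y, Rm (neumannIter Rm F k) y - Rm F' y = Rm (fun z => neumannIter Rm F k z - F' z) y := by
      intro y
      have h := picard_K_sub (K := Rm) hR2 hGk hF' y
      rw [h]; abel
    have e : (fun y => neumannIter Rm F (k + 1) y - F' y) = Rm (fun z => neumannIter Rm F k z - F' z) := by
      funext y
      rw [neumannIter_succ, hsol y]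
      simp only
      rw [← hsub y]; abel
    rw [e]
    refine (hR1 _ _ ih).mono ?_
    have hS' : 0 ≤ S' := hF'.nonneg
    have : θ * (S' * (1 / 2) ^ k) ≤ 1 / 2 * (S' * (1 / 2) ^ k) := mul_le_mul_of_nonneg_right hθ (by positivity)
    rw [pow_succ]; linarith

end One

/-! ## Parametric tightness and local continuity -/

section Param

variable {P : Type*} [PseudoMetricSpace P] {S : Set P}
  {Rm : P → (EuclideanSpace ℝ (Fin 3) → EuclideanSpace ℝ (Fin 3)) → EuclideanSpace ℝ (Fin 3) → EuclideanSpace ℝ (Fin 3)} {θ : ℝ}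

omit [PseudoMetricSpace P] in
/-- **Tightness of the iterates in values, uniformly in the parameter**: if `R_π` is tight in values uniformly (`Y(F) ≤ R₁` and `‖F‖ ≤ δ₀` on a ball `L′` ⇒
`‖R_π F‖ ≤ t` on the ball `L`), then so is every iterate `G_k^π`. -/
theorem neumannIter_tight
    (hR1 : ∀ π ∈ S, ∀ (G : EuclideanSpace ℝ (Fin 3) → EuclideanSpace ℝ (Fin 3)) (S' : ℝ), YBound G S' → YBound (Rm π G) (θ * S')) (hθ : θ ≤ 1 / 2)
    (hR3 : ∀ R₁ L t : ℝ, 0 < t → ∃ L' δ₀ : ℝ, 0 < δ₀ ∧ ∀ π ∈ S, ∀ F : EuclideanSpace ℝ (Fin 3) → EuclideanSpace ℝ (Fin 3),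
      YBound F R₁ → (∀ y, ‖y‖ ≤ L' → ‖F y‖ ≤ δ₀) → ∀ y, ‖y‖ ≤ L → ‖Rm π F y‖ ≤ t)
    (R₀ : ℝ) : ∀ k : ℕ, ∀ L t : ℝ, 0 < t → ∃ L' δ₀ : ℝ, 0 < δ₀ ∧ ∀ π ∈ S, ∀ F : EuclideanSpace ℝ (Fin 3) → EuclideanSpace ℝ (Fin 3),
      YBound F R₀ → (∀ y, ‖y‖ ≤ L' → ‖F y‖ ≤ δ₀) → ∀ y, ‖y‖ ≤ L → ‖neumannIter (Rm π) F k y‖ ≤ t := by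
  intro k
  induction k with
  | zero =>
    intro L t ht
    refine ⟨0, 1, one_pos, fun π _ F _ _ y _ => ?_⟩
    simp only [neumannIter_zero, norm_zero]; exact ht.le
  | succ k ih =>
    intro L t ht
    -- `R_π G_k` small on `L` once `G_k` (Y ≤ 2R₀) is small on some `L″`; `G_k` small on `L″` once `F` small on some `L‴`
    obtain ⟨L'', δ'', hδ'', h3⟩ := hR3 (2 * R₀) L (t / 2) (by positivity)
    obtain ⟨L''', δ''', hδ''', hk⟩ := ih L'' δ'' hδ''
    refine ⟨max L L''', min (t / 2) δ''', lt_min (by positivity) hδ''', fun π hπ F hF hsm y hy => ?_⟩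
    rw [neumannIter_succ]
    have hF' : ‖F y‖ ≤ t / 2 := (hsm y (hy.trans (le_max_left _ _))).trans (min_le_left _ _)
    have hGk : ∀ z, ‖z‖ ≤ L'' → ‖neumannIter (Rm π) F k z‖ ≤ δ'' :=
      hk π hπ F hF (fun z hz => (hsm z (hz.trans (le_max_right _ _))).trans (min_le_right _ _))
    have hRG : ‖Rm π (neumannIter (Rm π) F k) y‖ ≤ t / 2 := h3 π hπ _ (neumannIter_bound (hR1 π hπ) hθ hF k) hGk y hy
    calc ‖F y + Rm π (neumannIter (Rm π) F k) y‖ ≤ ‖F y‖ + ‖Rm π (neumannIter (Rm π) F k) y‖ := norm_add_le _ _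
      _ ≤ t / 2 + t / 2 := add_le_add hF' hRG
      _ = t := by ring

omit [PseudoMetricSpace P] in
/-- **Tightness of the Neumann solution operator in values, uniformly in the parameter.**  For any family of solution operators `N_π` (`Y(N_πF) ≤ 2Y(F)`,
`N_π F = F + R_π N_π F` on Y-bounded data): data with `Y ≤ R₀` small on a large ball give solutions small on a given ball, uniformly in `π ∈ S`. -/
theorem neumann_tight
    (hR1 : ∀ π ∈ S, ∀ (G : EuclideanSpace ℝ (Fin 3) → EuclideanSpace ℝ (Fin 3)) (S' : ℝ), YBound G S' → YBound (Rm π G) (θ * S'))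
    (hR2 : ∀ π ∈ S, ∀ (F G : EuclideanSpace ℝ (Fin 3) → EuclideanSpace ℝ (Fin 3)) (s : ℝ), (∃ S', YBound F S') → (∃ S', YBound G S') →
      Rm π (fun y => F y + s • G y) = fun y => Rm π F y + s • Rm π G y) (hθ : θ ≤ 1 / 2)
    (hR3 : ∀ R₁ L t : ℝ, 0 < t → ∃ L' δ₀ : ℝ, 0 < δ₀ ∧ ∀ π ∈ S, ∀ F : EuclideanSpace ℝ (Fin 3) → EuclideanSpace ℝ (Fin 3),
      YBound F R₁ → (∀ y, ‖y‖ ≤ L' → ‖F y‖ ≤ δ₀) → ∀ y, ‖y‖ ≤ L → ‖Rm π F y‖ ≤ t)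
    {Nop : P → (EuclideanSpace ℝ (Fin 3) → EuclideanSpace ℝ (Fin 3)) → EuclideanSpace ℝ (Fin 3) → EuclideanSpace ℝ (Fin 3)}
    (hN1 : ∀ π ∈ S, ∀ (F : EuclideanSpace ℝ (Fin 3) → EuclideanSpace ℝ (Fin 3)) (S' : ℝ), YBound F S' → YBound (Nop π F) (2 * S'))
    (hN2 : ∀ π ∈ S, ∀ (F : EuclideanSpace ℝ (Fin 3) → EuclideanSpace ℝ (Fin 3)) (S' : ℝ), YBound F S' → ∀ y, Nop π F y = F y + Rm π (Nop π F) y)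
    (R₀ L t : ℝ) (ht : 0 < t) : ∃ L' δ₀ : ℝ, 0 < δ₀ ∧ ∀ π ∈ S, ∀ F : EuclideanSpace ℝ (Fin 3) → EuclideanSpace ℝ (Fin 3),
      YBound F R₀ → (∀ y, ‖y‖ ≤ L' → ‖F y‖ ≤ δ₀) → ∀ y, ‖y‖ ≤ L → ‖Nop π F y‖ ≤ t := by
  -- truncation: `Y(G_k − N F) ≤ 4R₀ (1/2)^k ≤ t/2`
  obtain ⟨k, hk⟩ : ∃ k : ℕ, 8 * |R₀| / t < (2:ℝ) ^ k := pow_unbounded_of_one_lt _ one_lt_two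
  have hpow : (0:ℝ) < 2 ^ k := by positivity
  have htail : 2 * |R₀| * (1 / 2) ^ k ≤ t / 4 := by
    rw [one_div, inv_pow, ← div_eq_mul_inv, div_le_iff₀ hpow]
    have := (div_lt_iff₀ ht).mp hk
    nlinarith [abs_nonneg R₀]
  obtain ⟨L', δ₀, hδ₀, hK⟩ := neumannIter_tight hR1 hθ hR3 R₀ k L (t / 2) (by positivity)
  refine ⟨L', δ₀, hδ₀, fun π hπ F hF hsm y hy => ?_⟩
  have hR₀ : 0 ≤ R₀ := hF.nonneg
  have hNF := hN1 π hπ F R₀ hF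
  have hd := neumannIter_sub_solution (hR1 π hπ) (hR2 π hπ) hθ hF hNF (hN2 π hπ F R₀ hF) k
  have h1 : ‖neumannIter (Rm π) F k y - Nop π F y‖ ≤ 2 * R₀ * (1 / 2) ^ k := (hd.norm_le' y).1
  have h2 : ‖neumannIter (Rm π) F k y‖ ≤ t / 2 := hK π hπ F hF hsm y hy
  have h3 : 2 * R₀ * (1 / 2) ^ k ≤ t / 4 := by rw [← abs_of_nonneg hR₀]; exact htail
  calc ‖Nop π F y‖ = ‖neumannIter (Rm π) F k y - (neumannIter (Rm π) F k y - Nop π F y)‖ := by congr 1; abel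
    _ ≤ ‖neumannIter (Rm π) F k y‖ + ‖neumannIter (Rm π) F k y - Nop π F y‖ := norm_sub_le _ _
    _ ≤ t / 2 + t / 4 := add_le_add h2 (h1.trans h3)
    _ ≤ t := by linarith

/-- **Local continuity of the Neumann solution operator in the parameter** (values on balls): if moreover `R_π` is locally continuous in `π` at every Y-bounded
datum, then `‖N_π′ F − N_π F‖ ≤ t` on `‖y‖ ≤ L` for `π′` near `π`.  Mechanism: `d := N_π F − N_π′ F` solves `d = g + R_π′ d` with `g := (R_π − R_π′)(N_π F)`, so
`d = N_π′ g` (uniqueness) and the tightness of `N_π′` applies to the small datum `g`. -/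
theorem neumann_locClose
    (hR1 : ∀ π ∈ S, ∀ (G : EuclideanSpace ℝ (Fin 3) → EuclideanSpace ℝ (Fin 3)) (S' : ℝ), YBound G S' → YBound (Rm π G) (θ * S'))
    (hR2 : ∀ π ∈ S, ∀ (F G : EuclideanSpace ℝ (Fin 3) → EuclideanSpace ℝ (Fin 3)) (s : ℝ), (∃ S', YBound F S') → (∃ S', YBound G S') →
      Rm π (fun y => F y + s • G y) = fun y => Rm π F y + s • Rm π G y) (hθ : θ ≤ 1 / 2)
    (hR3 : ∀ R₁ L t : ℝ, 0 < t → ∃ L' δ₀ : ℝ, 0 < δ₀ ∧ ∀ π ∈ S, ∀ F : EuclideanSpace ℝ (Fin 3) → EuclideanSpace ℝ (Fin 3),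
      YBound F R₁ → (∀ y, ‖y‖ ≤ L' → ‖F y‖ ≤ δ₀) → ∀ y, ‖y‖ ≤ L → ‖Rm π F y‖ ≤ t)
    (hR4 : ∀ π ∈ S, ∀ (F : EuclideanSpace ℝ (Fin 3) → EuclideanSpace ℝ (Fin 3)) (R₁ L t : ℝ), YBound F R₁ → 0 < t →
      ∃ δ > 0, ∀ π' ∈ S, dist π' π < δ → ∀ y, ‖y‖ ≤ L → ‖Rm π' F y - Rm π F y‖ ≤ t)
    {Nop : P → (EuclideanSpace ℝ (Fin 3) → EuclideanSpace ℝ (Fin 3)) → EuclideanSpace ℝ (Fin 3) → EuclideanSpace ℝ (Fin 3)}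
    (hN1 : ∀ π ∈ S, ∀ (F : EuclideanSpace ℝ (Fin 3) → EuclideanSpace ℝ (Fin 3)) (S' : ℝ), YBound F S' → YBound (Nop π F) (2 * S'))
    (hN2 : ∀ π ∈ S, ∀ (F : EuclideanSpace ℝ (Fin 3) → EuclideanSpace ℝ (Fin 3)) (S' : ℝ), YBound F S' → ∀ y, Nop π F y = F y + Rm π (Nop π F) y)
    {π : P} (hπ : π ∈ S) {F : EuclideanSpace ℝ (Fin 3) → EuclideanSpace ℝ (Fin 3)} {R₀ : ℝ} (hF : YBound F R₀) (L t : ℝ) (ht : 0 < t) :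
    ∃ δ > 0, ∀ π' ∈ S, dist π' π < δ → (∀ y, ‖y‖ ≤ L → ‖Nop π' F y - Nop π F y‖ ≤ t) ∧
      YBound (fun y => Nop π' F y - Nop π F y) (2 * (θ * (2 * R₀) + θ * (2 * R₀))) := by
  have hR₀ : 0 ≤ R₀ := hF.nonneg
  have hNF := hN1 π hπ F R₀ hF
  -- tightness of the solution operators for data of size `2θ·2R₀` (the size of `g`)
  obtain ⟨L', δ₀, hδ₀, htight⟩ := neumann_tight hR1 hR2 hθ hR3 hN1 hN2 (θ * (2 * R₀) + θ * (2 * R₀)) L t ht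
  -- local continuity of `R` at the datum `N_π F`, target `δ₀` on `L′`
  obtain ⟨δ, hδ, h4⟩ := hR4 π hπ (Nop π F) _ L' δ₀ hNF hδ₀
  refine ⟨δ, hδ, fun π' hπ' hd => ?_⟩
  have hNF' := hN1 π' hπ' F R₀ hF
  -- `g := R_π(N_π F) − R_π′(N_π F)` and the identity `d = g + R_π′ d` for `d := N_π F − N_π′ F`
  set g : EuclideanSpace ℝ (Fin 3) → EuclideanSpace ℝ (Fin 3) := fun y => Rm π (Nop π F) y - Rm π' (Nop π F) y with hg
  have hgY : YBound g (θ * (2 * R₀) + θ * (2 * R₀)) := (hR1 π hπ _ _ hNF).sub (hR1 π' hπ' _ _ hNF)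
  have hgsm : ∀ y, ‖y‖ ≤ L' → ‖g y‖ ≤ δ₀ := fun y hy => by
    rw [hg]; simp only; rw [← norm_neg]; simpa using h4 π' hπ' hd y hy
  set d : EuclideanSpace ℝ (Fin 3) → EuclideanSpace ℝ (Fin 3) := fun y => Nop π F y - Nop π' F y with hdd
  have hdY : YBound d (2 * R₀ + 2 * R₀) := hNF.sub hNF'
  have hdsol : ∀ y, d y = g y + Rm π' d y := by
    intro y
    have hsplit := picard_K_sub (K := Rm π') (hR2 π' hπ') hNF hNF' y
    -- `R_π′(N_π F) = R_π′(N_π′ F) + R_π′ d`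
    have e1 := hN2 π hπ F R₀ hF y
    have e2 := hN2 π' hπ' F R₀ hF y
    show Nop π F y - Nop π' F y = (Rm π (Nop π F) y - Rm π' (Nop π F) y) + Rm π' (fun y => Nop π F y - Nop π' F y) y
    rw [hsplit] ; rw [e1, e2]; abel
  -- `d = N_π′ g` by uniqueness at the parameter `π′` (for `T := −R_π′`)
  have hT1 : ∀ (G : EuclideanSpace ℝ (Fin 3) → EuclideanSpace ℝ (Fin 3)) (S' : ℝ), YBound G S' → YBound (fun y => -Rm π' G y) (θ * S') :=
    fun G S' hG => (hR1 π' hπ' G S' hG).neg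
  have hT2 : ∀ (G H : EuclideanSpace ℝ (Fin 3) → EuclideanSpace ℝ (Fin 3)) (s : ℝ), (∃ S', YBound G S') → (∃ S', YBound H S') →
      (fun y => -Rm π' (fun y => G y + s • H y) y) = fun y => -Rm π' G y + s • -Rm π' H y := by
    intro G H s hG hH
    have h := hR2 π' hπ' G H s hG hH
    funext y; rw [h]; simp only [smul_neg]; abel
  have hNg := hN1 π' hπ' g _ hgY
  have heq : d = Nop π' g :=
    neumann_unique (T := fun G y => -Rm π' G y) hT1 hT2 hθ ⟨_, hdY⟩ ⟨_, hNg⟩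
      (fun y => by rw [hdsol y]; abel) (fun y => by rw [hN2 π' hπ' g _ hgY y]; abel)
  have hsmall : ∀ y, ‖y‖ ≤ L → ‖Nop π' g y‖ ≤ t := htight π' hπ' g hgY hgsm
  refine ⟨fun y hy => ?_, ?_⟩
  · have h := hsmall y hy
    rw [← heq] at h
    rw [← norm_neg]; simpa [hdd] using h
  · have h : YBound (Nop π' g) (2 * (θ * (2 * R₀) + θ * (2 * R₀))) := hNg
    rw [← heq] at h
    have e : (fun y => Nop π' F y - Nop π F y) = fun y => -d y := by funext y; simp [hdd]
    rw [e]; exact h.neg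

end Param

end Summit.NavierStokesRegularity.NavierStokesRegularity.Theorems.KelvinGate

end
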